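import Mathlib.Topology.Order.Compact
import Literature.Analysis.FluidPDE.CompressibleEulerImplosionSonicJointContinuity
import HarnessLib

/-!
# Buckmaster–Cao-Labora–Gómez-Serrano at γ = 5/3: the branch through `P_s`, uniformly in `r`

For the shooting argument of §6 of the paper the analytic branch `(W^{(r)}, Z^{(r)})` through
`P_s` (Props. 2.2–2.3) must be controlled on a time interval `|t| ≤ δ` which does not depend
on `r` in a compact window `[a, b] ⊂ (r₃, r₄)`. From the uniform geometric majorant of the
sonic series (the constants `geoK`, `geoM` are continuous in `r`) we get first- and
second-order tail estimates of the two series with uniform constants, whence a `δ > 0`,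
`δ < sonicRad r`, such that for all `r ∈ [a, b]` and `|t| ≤ δ`: `D_W > 0` and `Z < W` on the
branch, `|W − W₀|, |Z − Z₀| ≤ 1/4`; for `t < 0` (right of `P_s`): `D_Z < 0` and `W > W₀`; for `t > 0` (left of `P_s`):
`D_Z > 0` and `W < W₀` (`branch_uniform`). These are the hypotheses `hsonic`, `hsρ` of
`Monatomic.thm11_monatomic_of_meeting` in uniform form.

[cite: BuckmasterCaolaboraGomezserrano2025, Prop. 2.2, Prop. 2.3, §6]
-/

noncomputable section

open Set Filter Topology

namespace Literature.Analysis.FluidPDE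

namespace BuckmasterCaolaboraGomezserrano2025

namespace Monatomic

namespace SonicSeries

/-! ### Generic tail estimates for geometrically dominated power series -/

section Tails

variable {f : ℕ → ℝ} {K M : ℝ}

/-- `|Σ fₙ ξⁿ − f₀| ≤ 2 K M |ξ|` inside the radius. [folklore] -/
theorem abs_tsum_sub_head_le (hf : ∀ n, |f n| ≤ K * M ^ n) (hM : 0 ≤ M) {ξ : ℝ}
    (hξ : M * |ξ| ≤ 1 / 2) : |∑' n, f n * ξ ^ n - f 0| ≤ 2 * K * M * |ξ| := by
  have hK := nonneg_of_bound hf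
  have hs := hasSum_term hf hM hξ
  have h1 := (hasSum_nat_add_iff' 1).mpr hs
  simp only [Finset.sum_range_one, pow_zero, mul_one] at h1
  have hgeo : HasSum (fun m : ℕ => (1 / 2 : ℝ) ^ m) 2 := by
    have h := hasSum_geometric_of_lt_one (by norm_num : (0 : ℝ) ≤ 1 / 2) (by norm_num)
    norm_num at h
    exact h
  have hg : HasSum (fun m : ℕ => K * M * |ξ| * (1 / 2 : ℝ) ^ m) (K * M * |ξ| * 2) := hgeo.mul_left _
  have hb : ∀ m : ℕ, ‖f (m + 1) * ξ ^ (m + 1)‖ ≤ K * M * |ξ| * (1 / 2 : ℝ) ^ m := by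
    intro m
    rw [Real.norm_eq_abs, abs_mul, abs_pow]
    calc |f (m + 1)| * |ξ| ^ (m + 1) ≤ K * M ^ (m + 1) * |ξ| ^ (m + 1) := by gcongr; exact hf _
      _ = K * M * |ξ| * (M * |ξ|) ^ m := by ring
      _ ≤ K * M * |ξ| * (1 / 2 : ℝ) ^ m := by gcongr
  have key := HasSum.norm_le_of_bounded h1 hg hb
  rw [Real.norm_eq_abs] at key
  linarith

/-- `|Σ fₙ ξⁿ − f₀ − f₁ ξ| ≤ 2 K M² ξ²` inside the radius. [folklore] -/
theorem abs_tsum_sub_taylor_le (hf : ∀ n, |f n| ≤ K * M ^ n) (hM : 0 ≤ M) {ξ : ℝ}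
    (hξ : M * |ξ| ≤ 1 / 2) : |∑' n, f n * ξ ^ n - f 0 - f 1 * ξ| ≤ 2 * K * M ^ 2 * ξ ^ 2 := by
  have hK := nonneg_of_bound hf
  have hs := hasSum_term hf hM hξ
  have h2 := (hasSum_nat_add_iff' 2).mpr hs
  simp only [Finset.sum_range_succ, Finset.sum_range_zero, zero_add, pow_zero, mul_one, pow_one] at h2
  have hgeo : HasSum (fun m : ℕ => (1 / 2 : ℝ) ^ m) 2 := by
    have h := hasSum_geometric_of_lt_one (by norm_num : (0 : ℝ) ≤ 1 / 2) (by norm_num)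
    norm_num at h
    exact h
  have hg : HasSum (fun m : ℕ => K * M ^ 2 * ξ ^ 2 * (1 / 2 : ℝ) ^ m) (K * M ^ 2 * ξ ^ 2 * 2) :=
    hgeo.mul_left _
  have hb : ∀ m : ℕ, ‖f (m + 2) * ξ ^ (m + 2)‖ ≤ K * M ^ 2 * ξ ^ 2 * (1 / 2 : ℝ) ^ m := by
    intro m
    rw [Real.norm_eq_abs, abs_mul, abs_pow]
    calc |f (m + 2)| * |ξ| ^ (m + 2) ≤ K * M ^ (m + 2) * |ξ| ^ (m + 2) := by gcongr; exact hf _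
      _ = K * M ^ 2 * |ξ| ^ 2 * (M * |ξ|) ^ m := by ring
      _ ≤ K * M ^ 2 * |ξ| ^ 2 * (1 / 2 : ℝ) ^ m := by gcongr
      _ = K * M ^ 2 * ξ ^ 2 * (1 / 2 : ℝ) ^ m := by rw [sq_abs]
  have key := HasSum.norm_le_of_bounded h2 hg hb
  rw [Real.norm_eq_abs] at key
  have e : ∑' n, f n * ξ ^ n - f 0 - f 1 * ξ = ∑' n, f n * ξ ^ n - (f 0 + f 1 * ξ) := by ring
  rw [e]
  linarith

end Tails

/-! ### Elementary uniform bounds on `(r₃, r₄)` -/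

variable {r : ℝ}

/-- [folklore] -/
theorem q_ge (h4 : r < r4) : (69 / 100 : ℝ) ≤ q r := by
  have hm := r3_r4_mem
  have hr : r < rstar := h4.trans hm.2.2
  have hq := q_sq (disc_pos hr).le
  have hq0 := q_nonneg r
  have h4' : r < 1.13476 := h4.trans r4_bounds.2
  nlinarith

/-- [folklore] -/
theorem p_le (h3 : r3 < r) (h4 : r < r4) : p r ≤ (13 / 25 : ℝ) := by
  have hm := r3_r4_mem
  have h1 : 1 ≤ r := (hm.1.trans h3).le
  have hp := p_sq h1
  have hp0 := (p_pos (hm.1.trans h3)).le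
  have h4' : r < 1.13476 := h4.trans r4_bounds.2
  nlinarith

/-- [folklore] -/
theorem neg_of_taylor {D E1 E2 B c t : ℝ} (hD : D = (E1 + 2 * E2) / 3 + c * t) (h1 : E1 ≤ B)
    (h2 : E2 ≤ B) (hB : B ≤ -t / 4) (hc : 1 / 4 < c) (ht : t < 0) : D < 0 := by
  nlinarith [mul_pos (sub_pos.mpr hc) (neg_pos.mpr ht)]

/-- [folklore] -/
theorem pos_of_taylor {D E1 E2 B c t : ℝ} (hD : D = (E1 + 2 * E2) / 3 + c * t) (h1 : -B ≤ E1)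
    (h2 : -B ≤ E2) (hB : B ≤ t / 4) (hc : 1 / 4 < c) (ht : 0 < t) : 0 < D := by
  nlinarith [mul_pos (sub_pos.mpr hc) ht]

/-- [folklore] -/
theorem pos_of_taylor' {X E B s t : ℝ} (hX : X = E - s * t) (h1 : -B ≤ E) (hB : B ≤ -t / 4)
    (hs : 2 ≤ s) (ht : t < 0) : 0 < X := by
  nlinarith [mul_pos (by linarith : (0 : ℝ) < s - 1 / 4) (neg_pos.mpr ht)]

/-- [folklore] -/
theorem neg_of_taylor' {X E B s t : ℝ} (hX : X = E - s * t) (h1 : E ≤ B) (hB : B ≤ t / 4)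
    (hs : 2 ≤ s) (ht : 0 < t) : X < 0 := by
  nlinarith [mul_pos (by linarith : (0 : ℝ) < s - 1 / 4) ht]

/-- **The branch near `P_s`, uniformly in `r`** (see the module docstring).
[cite: BuckmasterCaolaboraGomezserrano2025, Prop. 2.2, Prop. 2.3, §6] -/
theorem branch_uniform {a b : ℝ} (ha : r3 < a) (hb : b < r4) (hab : a ≤ b) :
    ∃ δ : ℝ, 0 < δ ∧ ∀ r ∈ Icc a b, δ < sonicRad r ∧
      ∀ t : ℝ, |t| ≤ δ →
        (0 < DW (Wloc r t) (Zloc r t) ∧ Zloc r t < Wloc r t ∧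
          |Wloc r t - W0 r| ≤ 1 / 4 ∧ |Zloc r t - Z0 r| ≤ 1 / 4) ∧
        (t < 0 → DZ (Wloc r t) (Zloc r t) < 0 ∧ W0 r < Wloc r t) ∧
        (0 < t → 0 < DZ (Wloc r t) (Zloc r t) ∧ Wloc r t < W0 r) := by
  have hm := r3_r4_mem
  have hJ : Icc a b ⊆ Ioo r3 r4 := fun r hr => ⟨ha.trans_le hr.1, hr.2.trans_lt hb⟩
  have hJc : IsCompact (Icc a b) := isCompact_Icc
  have hJn : (Icc a b).Nonempty := nonempty_Icc.mpr hab
  obtain ⟨rM, hrM, hMmax⟩ := hJc.exists_isMaxOn hJn (continuousOn_geoM.mono hJ)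
  obtain ⟨rK, hrK, hKmax⟩ := hJc.exists_isMaxOn hJn (continuousOn_geoK.mono hJ)
  set Ms := geoM rM with hMs
  set Ks := geoK rK with hKs
  have hMs4 : 4 ≤ Ms := four_le_geoM ((hJ hrM).2.trans hm.2.2)
  have hMs0 : 0 < Ms := by linarith
  have hKs0 : 0 < Ks := geoK_pos rK
  have hMle : ∀ r ∈ Icc a b, geoM r ≤ Ms := fun r hr => hMmax hr
  have hKle : ∀ r ∈ Icc a b, geoK r ≤ Ks := fun r hr => hKmax hr
  -- uniform coefficient bounds
  have hav : ∀ r ∈ Icc a b, ∀ n, av r n ≤ Ks * Ms ^ n := by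
    intro r hr n
    have h4M := four_le_geoM ((hJ hr).2.trans hm.2.2)
    calc av r n ≤ geoK r * geoM r ^ n := av_le_geom (hJ hr).1 (hJ hr).2 n
      _ ≤ Ks * Ms ^ n :=
          mul_le_mul (hKle r hr) (pow_le_pow_left₀ (by linarith) (hMle r hr) n)
            (by positivity) hKs0.le
  have hw : ∀ r ∈ Icc a b, ∀ n, |w r n| ≤ Ks * Ms ^ n := fun r hr n => (abs_w_le_av n).trans (hav r hr n)
  have hz : ∀ r ∈ Icc a b, ∀ n, |z r n| ≤ Ks * Ms ^ n := fun r hr n => (abs_z_le_av n).trans (hav r hr n)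
  set C1 : ℝ := 2 * Ks * Ms with hC1
  set C2 : ℝ := 2 * Ks * Ms ^ 2 with hC2
  have hC1pos : 0 < C1 := by positivity
  have hC2pos : 0 < C2 := by positivity
  set δ : ℝ := min (1 / (4 * Ms)) (min (1 / (4 * C1)) (1 / (4 * C2))) with hδ
  have hδpos : 0 < δ := by positivity
  have hδM : δ ≤ 1 / (4 * Ms) := min_le_left _ _
  have hδ1 : δ ≤ 1 / (4 * C1) := (min_le_right _ _).trans (min_le_left _ _)
  have hδ2 : δ ≤ 1 / (4 * C2) := (min_le_right _ _).trans (min_le_right _ _)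
  refine ⟨δ, hδpos, fun r hr => ⟨?_, fun t ht => ?_⟩⟩
  · -- `δ < sonicRad r`
    unfold sonicRad
    have h4M := four_le_geoM ((hJ hr).2.trans hm.2.2)
    have hle := hMle r hr
    calc δ ≤ 1 / (4 * Ms) := hδM
      _ < 1 / (2 * geoM r) := by
          rw [div_lt_div_iff₀ (by positivity) (by positivity)]; nlinarith
  · have h3 := (hJ hr).1
    have h4 := (hJ hr).2
    have hr' : r < rstar := h4.trans hm.2.2
    have hr2 : r < 2 := by linarith [rstar_lt]
    have hMt : Ms * |t| ≤ 1 / 2 := by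
      have : Ms * |t| ≤ Ms * (1 / (4 * Ms)) := by gcongr; exact ht.trans hδM
      rw [show Ms * (1 / (4 * Ms)) = 1 / 4 by field_simp] at this
      linarith
    -- tail estimates for `W` and `Z`
    have eW1 := abs_tsum_sub_head_le (hw r hr) hMs0.le hMt
    have eZ1 := abs_tsum_sub_head_le (hz r hr) hMs0.le hMt
    have eW2 := abs_tsum_sub_taylor_le (hw r hr) hMs0.le hMt
    have eZ2 := abs_tsum_sub_taylor_le (hz r hr) hMs0.le hMt
    rw [← Wloc, w_zero] at eW1; rw [← Zloc, z_zero] at eZ1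
    rw [← Wloc, w_zero, w_one] at eW2; rw [← Zloc, z_zero, z_one] at eZ2
    have hC1t : C1 * |t| ≤ 1 / 4 := by
      have : C1 * |t| ≤ C1 * (1 / (4 * C1)) := by gcongr; exact ht.trans hδ1
      rw [show C1 * (1 / (4 * C1)) = 1 / 4 by field_simp] at this
      exact this
    have hC2t : C2 * |t| ≤ 1 / 4 := by
      have : C2 * |t| ≤ C2 * (1 / (4 * C2)) := by gcongr; exact ht.trans hδ2
      rw [show C2 * (1 / (4 * C2)) = 1 / 4 by field_simp] at this
      exact this
    have aW1 := abs_le.mp (eW1.trans (by nlinarith [abs_nonneg t] : 2 * Ks * Ms * |t| ≤ 1 / 4))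
    have aZ1 := abs_le.mp (eZ1.trans (by nlinarith [abs_nonneg t] : 2 * Ks * Ms * |t| ≤ 1 / 4))
    have aW2 := abs_le.mp eW2
    have aZ2 := abs_le.mp eZ2
    have hq := q_ge h4
    have hp := p_le h3 h4
    have hq0 := q_nonneg r
    have ht2 : 2 * Ks * Ms ^ 2 * t ^ 2 = C2 * |t| * |t| := by
      rw [hC2, show t ^ 2 = |t| * |t| by rw [← sq_abs]; ring]; ring
    have hsmall : 2 * Ks * Ms ^ 2 * t ^ 2 ≤ 1 / 4 * |t| := by
      rw [ht2]; exact mul_le_mul_of_nonneg_right hC2t (abs_nonneg t)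
    have iDW : DW (Wloc r t) (Zloc r t)
        = (2 - r + q r) + (2 * (Wloc r t - W0 r) + (Zloc r t - Z0 r)) / 3 := by
      unfold DW W0 Z0; ring
    have iWZ : Wloc r t - Zloc r t = (6 - 3 * r + 3 * q r) + ((Wloc r t - W0 r) - (Zloc r t - Z0 r)) := by
      unfold W0 Z0; ring
    have iDZ : DZ (Wloc r t) (Zloc r t)
        = ((Wloc r t - W0 r - W1 r * t) + 2 * (Zloc r t - Z0 r - Z1 r * t)) / 3 + (2 - r - p r) * t := by
      unfold DZ W0 Z0 W1 Z1; ring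
    have iW : Wloc r t - W0 r = (Wloc r t - W0 r - W1 r * t) - 3 * q r * t := by
      unfold W1; ring
    have hc : (1 / 4 : ℝ) < 2 - r - p r := by
      have h4' : r < 1.13476 := h4.trans r4_bounds.2
      linarith
    have hs3 : (2 : ℝ) ≤ 3 * q r := by linarith
    refine ⟨⟨?_, ?_, abs_le.mpr aW1, abs_le.mpr aZ1⟩, fun htneg => ⟨?_, ?_⟩, fun htpos => ⟨?_, ?_⟩⟩
    · rw [iDW]; linarith [aW1.1, aZ1.1]
    · have : 0 < Wloc r t - Zloc r t := by rw [iWZ]; linarith [aW1.1, aZ1.2]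
      linarith
    · have hta : |t| = -t := abs_of_neg htneg
      rw [hta] at hsmall
      exact neg_of_taylor iDZ aW2.2 aZ2.2 (by linarith) hc htneg
    · have hta : |t| = -t := abs_of_neg htneg
      rw [hta] at hsmall
      have := pos_of_taylor' iW aW2.1 (by linarith) hs3 htneg
      linarith
    · have hta : |t| = t := abs_of_pos htpos
      rw [hta] at hsmall
      exact pos_of_taylor iDZ aW2.1 aZ2.1 (by linarith) hc htpos
    · have hta : |t| = t := abs_of_pos htpos
      rw [hta] at hsmall
      have := neg_of_taylor' iW aW2.2 (by linarith) hs3 htpos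
      linarith

end SonicSeries

end Monatomic

end BuckmasterCaolaboraGomezserrano2025

end Literature.Analysis.FluidPDE
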